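import Mathlib
import Summits.ValiantsHypothesis.ValiantsHypothesis.Theorems.LacunarySymmetroidMatrixDescartesCensusDefs
import Summits.ValiantsHypothesis.ValiantsHypothesis.Theorems.LacunarySymmetroidMatrixDescartesCensusBox20Reduce
import Summits.ValiantsHypothesis.ValiantsHypothesis.Theorems.KPlusLogSqLawWeakLiftingTowerGraftExponentHalvingGram

/-!
# Tower graft line — RANK-REFINED HALVING: a rank-`r` far letter is halved at the price of `r` extra rows

Sequel to `…TowerGraftExponentHalvingGram.lean` (same seat), LINE (B) `Cruxes/WeakLifting/Lines/tower_graft.lean` of the crux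
`WeakLifting` (stmt-ValiantsHypothesis-19561); calibration tier, NO stub is claimed.

The Gram clearing of the prequel is stated for a rectangular `U : ι × κ`: for a far letter given in FACTORED form `L = U·W·Uᵀ`
(`W : κ × κ` a symmetric involution — the spectral signs `diag(±1)` of a rank-`|κ|` letter, or the pairing `[[0,1],[1,0]]`), the
bordering `[[G, X^b·U], [X^b·Uᵀ, −X^e·W]]` lives on `ι ⊕ κ` and has determinant `± X^{e|κ|}·det (G + X^{2b−e}·L)`.  So ONE HALVING OF A
RANK-`r` LETTER COSTS ONLY `r` EXTRA ROWS (§1, `card_posRoots_graft_halve_le`): the positive roots of `det (G + X^{2b−e}·UWUᵀ)` (`G` a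
`K`-letter symmetric pencil of size `m` on `d`, `e = d l₁ ≤ 2b`) number at most `B` whenever `PosRootLawOn (m + r) (K+1) B (d, b)`.
The new far letter `[[0,U],[Uᵀ,0]] = U′·[[0,1],[1,0]]·U′ᵀ` (`U′ = U ⊕ 1`, §2 `fromBlocks_zero_eq_gram`) is again factored, of rank index
`κ ⊕ κ`; iterating (§2, `card_posRoots_graft_dyadic_le`, induction with the rank index doubling) a factored letter of rank `r` at level
`j·d l₁`, `j ≤ 2ⁿ`, on a support through `0` is absorbed by the `K`-letter class at size `m + r·(2ⁿ − 1)`: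
* CORNER GRAFT (`r = 1`, S4b's object `det G + X^D·det G_{ii}`): on supports through `0, 1`, `Z₊ ≤ ζ₊(m + 2^{⌊log₂D⌋+1} − 1; d) ≤ ζ₊(m + 2D − 1; d)`
  (`card_posRoots_cornerGraft_le_of_log`) — ADDITIVE size cost, linear in the level; the prequel's all-rank statement costs `2^{⌊log₂D⌋+1}·m`.
READING (honest).  For the line's FAR corner grafts (`D > m·max d`) the `D`-independent absorption at size `2m+1` of
`…TowerGraftResidualDeterminant` (lift-p3 g16, Rolle–Schur residual) is sharper; the rank-refined exchange wins for NEAR letters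
(`2^{⌊log₂D⌋+1} ≤ m + 1`, i.e. a letter INSERTED inside the tower's range) and for ranks `2 ≤ r < m`, where no `D`-independent absorption is
known.  Size superadditivity still forbids turning any of this into S5's `2^C·B`.  Zero stub credit; nothing on S4/S4b/S4d/S4f/S5/S5ᴸ,
TowerB, `WeakLifting`, Conjecture B, 18050 or VP ≠ VNP.  Def-free; Mathlib + two census files + the prequel.  Seat: prover val-sym-lift-p2
g22 (`prover-val-sym-lift-p2-g22-0`), `--supports stmt-ValiantsHypothesis-19561 --as helper`.
-/

-- `Summit.ValiantsHypothesis.ValiantsHypothesis.…` repeats a component by the D-0017 layout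
-- (single-conjunct summit), which the `dupNamespace` linter flags; the name is mandated.
set_option linter.dupNamespace false

namespace Summit.ValiantsHypothesis.ValiantsHypothesis.Theorems.KPlusLogSqLaw.TowerGraft

open Finset Polynomial Matrix
open scoped BigOperators Polynomial
open Summit.ValiantsHypothesis.ValiantsHypothesis.Theorems.LacunarySymmetroidMatrixDescartes (PosRootLawOn)

/-! ## §0 Transport of the class budget to an arbitrary index type -/

section Transport

variable {K B : ℕ}

/-- the class budget `PosRootLawOn (card ι) K B d` bounds the positive roots of every symmetric `K`-letter pencil indexed by the
finite type `ι` (reindexing along `ι ≃ Fin (card ι)`). [folklore] -/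
theorem card_posRoots_le_of_posRootLawOn_card {ι : Type*} [Fintype ι] [DecidableEq ι] (d : Fin K → ℕ)
    (h : PosRootLawOn (Fintype.card ι) K B d) (T : Fin K → Matrix ι ι ℝ) (hT : ∀ l, (T l).IsSymm) :
    ((∑ l, (X : ℝ[X]) ^ d l • (T l).map C).det.roots.toFinset.filter (fun t => 0 < t)).card ≤ B := by
  set e : ι ≃ Fin (Fintype.card ι) := Fintype.equivFin ι
  have hB := h (fun l => Matrix.reindex e e (T l)) (fun l => (hT l).submatrix _)
  have hre : (∑ l, (X : ℝ[X]) ^ d l • (Matrix.reindex e e (T l)).map C) =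
      Matrix.reindex e e (∑ l, (X : ℝ[X]) ^ d l • (T l).map C) := by
    refine Matrix.ext fun i j => ?_
    simp only [Matrix.sum_apply, Matrix.smul_apply, Matrix.map_apply, Matrix.reindex_apply, Matrix.submatrix_apply]
  rw [hre, Matrix.det_reindex_self] at hB
  exact hB

end Transport

/-! ## §1 One halving of a factored far letter `U·W·Uᵀ` costs `|κ|` extra rows -/

section HalveRank

variable {ι κ : Type*} [Fintype ι] [DecidableEq ι] [Fintype κ] [DecidableEq κ] {K B : ℕ}

omit [Fintype ι] [DecidableEq ι] [Fintype κ] [DecidableEq κ] in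
/-- the rank-refined bordered letters on `ι ⊕ κ`: letter `l₁` carries the sign corner `−W`, the far letter is `[[0,U],[Uᵀ,0]]` at the
halved level `b`; entrywise identification with the Gram bordering of the base pencil. [this work] -/
theorem borderGramRank_pencil_eq (d : Fin K → ℕ) (l₁ : Fin K) (b : ℕ)
    (S : Fin K → Matrix ι ι ℝ) (U : Matrix ι κ ℝ) (W : Matrix κ κ ℝ) :
    (∑ l, (X : ℝ[X]) ^ (Fin.snoc d b : Fin (K + 1) → ℕ) l •
        ((Fin.snoc (α := fun _ => Matrix (ι ⊕ κ) (ι ⊕ κ) ℝ)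
            (fun l => fromBlocks (S l) 0 0 (if l = l₁ then -W else 0))
            (fromBlocks 0 U Uᵀ 0) l).map C)) =
      fromBlocks (∑ l, (X : ℝ[X]) ^ d l • (S l).map C)
        ((X : ℝ[X]) ^ b • U.map C) ((X : ℝ[X]) ^ b • (U.map C)ᵀ)
        (-((X : ℝ[X]) ^ d l₁ • W.map C)) := by
  have hcorner : ∀ p q, (∑ x, C ((if x = l₁ then -W else 0) p q) * (X : ℝ[X]) ^ d x) =
      -((X : ℝ[X]) ^ d l₁ * C (W p q)) := by
    intro p q
    rw [Finset.sum_eq_single l₁ (fun x _ hx => by rw [if_neg hx, Matrix.zero_apply, C_0, zero_mul])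
      (fun h => absurd (Finset.mem_univ _) h), if_pos rfl, Matrix.neg_apply, C_neg, neg_mul, mul_comm]
  refine Matrix.ext fun i j => ?_
  rw [Matrix.sum_apply, Fin.sum_univ_castSucc]
  simp only [Fin.snoc_castSucc, Fin.snoc_last, Matrix.smul_apply, Matrix.map_apply, smul_eq_mul]
  rcases i with i | i <;> rcases j with j | j <;>
    simp [Matrix.sum_apply, hcorner]

open Summit.ValiantsHypothesis.ValiantsHypothesis.Theorems.LacunarySymmetroidMatrixDescartes.Census in
/-- **the rank-refined bordering has the same positive roots as the graft.**  For a symmetric involution `W` (`W·W = 1`, `Wᵀ = W`),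
`e = d l₁ ≤ 2b`: the positive roots of `det (G + X^{2b−e}·U W Uᵀ)` are those of the bordered pencil on `ι ⊕ κ`. [this work] -/
theorem posRoots_graft_eq_posRoots_border (d : Fin K → ℕ) (l₁ : Fin K) (b : ℕ) (hb : d l₁ ≤ 2 * b)
    (S : Fin K → Matrix ι ι ℝ) (U : Matrix ι κ ℝ) (W : Matrix κ κ ℝ) (hWW : W * W = 1) :
    (((∑ l, (X : ℝ[X]) ^ d l • (S l).map C) + (X : ℝ[X]) ^ (2 * b - d l₁) • (U * W * Uᵀ).map C).det.roots.toFinset.filter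
        (fun t => 0 < t)) =
      ((∑ l, (X : ℝ[X]) ^ (Fin.snoc d b : Fin (K + 1) → ℕ) l •
        ((Fin.snoc (α := fun _ => Matrix (ι ⊕ κ) (ι ⊕ κ) ℝ)
            (fun l => fromBlocks (S l) 0 0 (if l = l₁ then -W else 0))
            (fromBlocks 0 U Uᵀ 0) l).map C)).det.roots.toFinset.filter (fun t => 0 < t)) := by
  set G : Matrix ι ι ℝ[X] := ∑ l, (X : ℝ[X]) ^ d l • (S l).map C with hG
  have hWW' : W.map C * W.map C = (1 : Matrix κ κ ℝ[X]) := by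
    rw [← Matrix.map_mul, hWW, Matrix.map_one C C_0 C_1]
  have hdetW : W.det * W.det = 1 := by rw [← det_mul, hWW, det_one]
  have hdetW0 : W.det ≠ 0 := left_ne_zero_of_mul_eq_one hdetW
  have hUt : (U.map C)ᵀ = Uᵀ.map C := Matrix.transpose_map
  have hXe : ((X : ℝ[X]) ^ d l₁) ^ Fintype.card ι ≠ 0 := pow_ne_zero _ (pow_ne_zero _ X_ne_zero)
  have hclear := det_borderGram_smul_mul G (U.map C) (W.map C) hWW' ((X : ℝ[X]) ^ b) ((X : ℝ[X]) ^ d l₁)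
  have hLmap : U.map C * W.map C * (U.map C)ᵀ = (U * W * Uᵀ).map C := by
    rw [hUt, ← Matrix.map_mul, ← Matrix.map_mul]
  have hfactor : (X : ℝ[X]) ^ d l₁ • G + ((X : ℝ[X]) ^ b * (X : ℝ[X]) ^ b) • (U.map C * W.map C * (U.map C)ᵀ) =
      (X : ℝ[X]) ^ d l₁ • (G + (X : ℝ[X]) ^ (2 * b - d l₁) • (U * W * Uᵀ).map C) := by
    rw [hLmap, smul_add, smul_smul, ← pow_add, ← pow_add, ← two_mul, Nat.add_sub_cancel' hb]
  have hnegW : (-((X : ℝ[X]) ^ d l₁ • W.map C)).det =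
      (-1) ^ Fintype.card κ * ((X : ℝ[X]) ^ d l₁) ^ Fintype.card κ * C W.det := by
    rw [det_neg, det_smul, ← RingHom.mapMatrix_apply, ← RingHom.map_det]
    ring
  rw [hfactor, det_smul, hnegW] at hclear
  have hdet : (∑ l, (X : ℝ[X]) ^ (Fin.snoc d b : Fin (K + 1) → ℕ) l •
        ((Fin.snoc (α := fun _ => Matrix (ι ⊕ κ) (ι ⊕ κ) ℝ)
            (fun l => fromBlocks (S l) 0 0 (if l = l₁ then -W else 0))
            (fromBlocks 0 U Uᵀ 0) l).map C)).det =
      (X : ℝ[X]) ^ (d l₁ * Fintype.card κ) * (C ((-1) ^ Fintype.card κ * W.det) *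
        (G + (X : ℝ[X]) ^ (2 * b - d l₁) • (U * W * Uᵀ).map C).det) := by
    rw [borderGramRank_pencil_eq]
    refine mul_right_cancel₀ hXe ?_
    rw [hclear, ← pow_mul, ← pow_mul, C_mul, C_pow, C_neg, C_1]
    ring
  have hc0 : (-1 : ℝ) ^ Fintype.card κ * W.det ≠ 0 := mul_ne_zero (pow_ne_zero _ (by norm_num)) hdetW0
  have hroots := posRoots_X_pow_mul_eq (d l₁ * Fintype.card κ)
    (C ((-1 : ℝ) ^ Fintype.card κ * W.det) * (G + (X : ℝ[X]) ^ (2 * b - d l₁) • (U * W * Uᵀ).map C).det)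
  rw [Polynomial.roots_C_mul _ hc0, ← hdet] at hroots
  exact hroots.symm

/-- **ONE HALVING OF A RANK-`r` LETTER COSTS `r` EXTRA ROWS.**  `G` a symmetric `K`-letter pencil on `d` indexed by `ι`, a far letter in
factored form `U·W·Uᵀ` (`U : ι × κ`, `W` a symmetric involution) at level `2b − d l₁`: its positive roots number at most `B` whenever
`PosRootLawOn (|ι| + |κ|) (K+1) B (d, b)` — the `(K+1)`-letter class at the HALVED level and size `|ι| + |κ|`. [this work] -/
theorem card_posRoots_graft_halve_le (d : Fin K → ℕ) (l₁ : Fin K) (b : ℕ) (hb : d l₁ ≤ 2 * b)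
    (h : PosRootLawOn (Fintype.card ι + Fintype.card κ) (K + 1) B (Fin.snoc d b))
    (S : Fin K → Matrix ι ι ℝ) (hS : ∀ l, (S l).IsSymm) (U : Matrix ι κ ℝ) (W : Matrix κ κ ℝ)
    (hWW : W * W = 1) (hWt : Wᵀ = W) :
    ((((∑ l, (X : ℝ[X]) ^ d l • (S l).map C) + (X : ℝ[X]) ^ (2 * b - d l₁) • (U * W * Uᵀ).map C).det.roots.toFinset.filter
        (fun t => 0 < t)).card) ≤ B := by
  rw [posRoots_graft_eq_posRoots_border d l₁ b hb S U W hWW]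
  have hcard : Fintype.card (ι ⊕ κ) = Fintype.card ι + Fintype.card κ := Fintype.card_sum
  rw [← hcard] at h
  refine card_posRoots_le_of_posRootLawOn_card (Fin.snoc d b) h _ fun l => ?_
  refine Fin.lastCases ?_ (fun l => ?_) l
  · simp only [Fin.snoc_last, Matrix.IsSymm, fromBlocks_transpose, transpose_zero, transpose_transpose]
  · simp only [Fin.snoc_castSucc, Matrix.IsSymm, fromBlocks_transpose, transpose_zero, (hS _).eq]
    congr 1
    split_ifs
    · rw [transpose_neg, hWt]
    · rw [transpose_zero]

end HalveRank

/-! ## §2 Iteration: a factored letter of rank `r` at a dyadic multiple of a level is absorbed at size `m + r·(2ⁿ − 1)` -/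

section Dyadic

variable {K B : ℕ}

/-- the bordered far letter is again factored, with the rank index doubled: `[[0,U],[Uᵀ,0]] = U′·[[0,1],[1,0]]·U′ᵀ`, `U′ = U ⊕ 1`.
[folklore] -/
theorem fromBlocks_offDiag_eq_gram {ι κ : Type*} [Fintype κ] [DecidableEq κ] (U : Matrix ι κ ℝ) :
    fromBlocks (0 : Matrix ι ι ℝ) U Uᵀ (0 : Matrix κ κ ℝ) =
      (fromBlocks U (0 : Matrix ι κ ℝ) (0 : Matrix κ κ ℝ) (1 : Matrix κ κ ℝ)) *
        (fromBlocks (0 : Matrix κ κ ℝ) (1 : Matrix κ κ ℝ) (1 : Matrix κ κ ℝ) (0 : Matrix κ κ ℝ)) *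
        (fromBlocks U (0 : Matrix ι κ ℝ) (0 : Matrix κ κ ℝ) (1 : Matrix κ κ ℝ))ᵀ := by
  rw [fromBlocks_transpose, fromBlocks_multiply, fromBlocks_multiply]
  simp

/-- the pairing `[[0,1],[1,0]]` is a symmetric involution. [folklore] -/
theorem pairing_mul_pairing {κ : Type*} [Fintype κ] [DecidableEq κ] :
    (fromBlocks (0 : Matrix κ κ ℝ) (1 : Matrix κ κ ℝ) (1 : Matrix κ κ ℝ) (0 : Matrix κ κ ℝ)) *
      (fromBlocks (0 : Matrix κ κ ℝ) (1 : Matrix κ κ ℝ) (1 : Matrix κ κ ℝ) (0 : Matrix κ κ ℝ)) = 1 := by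
  rw [fromBlocks_multiply, ← fromBlocks_one]
  simp

/-- the pairing `[[0,1],[1,0]]` is symmetric. [folklore] -/
theorem pairing_transpose {κ : Type*} [DecidableEq κ] :
    (fromBlocks (0 : Matrix κ κ ℝ) (1 : Matrix κ κ ℝ) (1 : Matrix κ κ ℝ) (0 : Matrix κ κ ℝ))ᵀ =
      fromBlocks (0 : Matrix κ κ ℝ) (1 : Matrix κ κ ℝ) (1 : Matrix κ κ ℝ) (0 : Matrix κ κ ℝ) := by
  rw [fromBlocks_transpose, transpose_zero, transpose_one]

/-- merging a factored letter that sits AT an existing level `d l` into the letter `l` (symmetric since `Wᵀ = W`). [folklore] -/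
theorem card_posRoots_graft_self_le {ι κ : Type*} [Fintype ι] [DecidableEq ι] [Fintype κ]
    (d : Fin K → ℕ) (l : Fin K) (h : PosRootLawOn (Fintype.card ι) K B d)
    (S : Fin K → Matrix ι ι ℝ) (hS : ∀ l, (S l).IsSymm) (U : Matrix ι κ ℝ) (W : Matrix κ κ ℝ) (hWt : Wᵀ = W) :
    ((((∑ l', (X : ℝ[X]) ^ d l' • (S l').map C) + (X : ℝ[X]) ^ d l • (U * W * Uᵀ).map C).det.roots.toFinset.filter
        (fun t => 0 < t)).card) ≤ B := by
  have key : (∑ l', (X : ℝ[X]) ^ d l' • (S l').map C) + (X : ℝ[X]) ^ d l • (U * W * Uᵀ).map C =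
      ∑ l', (X : ℝ[X]) ^ d l' • (S l' + if l' = l then U * W * Uᵀ else 0).map C := by
    have hmap : ∀ l', ((S l' + if l' = l then U * W * Uᵀ else 0).map C) =
        (S l').map C + if l' = l then (U * W * Uᵀ).map C else 0 := by
      intro l'
      split_ifs
      · exact Matrix.ext fun i j => by simp only [Matrix.map_apply, Matrix.add_apply, map_add]
      · rw [add_zero, add_zero]
    simp_rw [hmap, smul_add, Finset.sum_add_distrib, smul_ite, smul_zero, Finset.sum_ite_eq' Finset.univ l,
      if_pos (Finset.mem_univ l)]
  rw [key]
  refine card_posRoots_le_of_posRootLawOn_card d h _ fun l' => (hS l').add ?_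
  split_ifs
  · rw [Matrix.IsSymm, Matrix.transpose_mul, Matrix.transpose_mul, transpose_transpose, hWt, Matrix.mul_assoc]
  · exact Matrix.isSymm_zero

/-- **DYADIC ABSORPTION OF A FACTORED LETTER, RANK-REFINED.**  On a support `d` through the level `0` (letter `l₀`), for every letter
`l₁`, every `n` and every `j ≤ 2ⁿ`: a symmetric `K`-letter pencil indexed by `ι` plus a factored far letter `U·W·Uᵀ` (`U : ι × κ`, `W` a
symmetric involution) at level `j·d l₁` has at most `B` positive roots whenever `PosRootLawOn (|ι| + |κ|·(2ⁿ − 1)) K B d` — binary descent on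
`j` as in the prequels, each halving adding `|κ|` rows and DOUBLING the rank index (`κ ↦ κ ⊕ κ`). [this work] -/
theorem card_posRoots_graft_dyadic_le (d : Fin K → ℕ) (l₀ : Fin K) (hl₀ : d l₀ = 0) (l₁ : Fin K) (n : ℕ) :
    ∀ {ι κ : Type} [Fintype ι] [DecidableEq ι] [Fintype κ] [DecidableEq κ] (j : ℕ), j ≤ 2 ^ n →
      PosRootLawOn (Fintype.card ι + Fintype.card κ * (2 ^ n - 1)) K B d →
      ∀ (S : Fin K → Matrix ι ι ℝ), (∀ l, (S l).IsSymm) → ∀ (U : Matrix ι κ ℝ) (W : Matrix κ κ ℝ), W * W = 1 → Wᵀ = W →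
        ((((∑ l, (X : ℝ[X]) ^ d l • (S l).map C) + (X : ℝ[X]) ^ (d l₁ * j) • (U * W * Uᵀ).map C).det.roots.toFinset.filter
          (fun t => 0 < t)).card) ≤ B := by
  induction n with
  | zero =>
    intro ι κ _ _ _ _ j hj h S hS U W _ hWt
    rw [pow_zero, Nat.sub_self, mul_zero, add_zero] at h
    rw [pow_zero] at hj
    rcases Nat.le_one_iff_eq_zero_or_eq_one.mp hj with rfl | rfl
    · rw [mul_zero, ← hl₀]
      exact card_posRoots_graft_self_le d l₀ h S hS U W hWt
    · rw [mul_one]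
      exact card_posRoots_graft_self_le d l₁ h S hS U W hWt
  | succ n ih =>
    intro ι κ _ _ _ _ j hj h S hS U W hWW hWt
    -- the budget at the next size, for the bordered pencil on `ι ⊕ κ` with rank index `κ ⊕ κ`
    have h' : PosRootLawOn (Fintype.card (ι ⊕ κ) + Fintype.card (κ ⊕ κ) * (2 ^ n - 1)) K B d := by
      have e : Fintype.card (ι ⊕ κ) + Fintype.card (κ ⊕ κ) * (2 ^ n - 1) =
          Fintype.card ι + Fintype.card κ * (2 ^ (n + 1) - 1) := by
        rw [Fintype.card_sum, Fintype.card_sum, pow_succ]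
        have h1 : 1 ≤ 2 ^ n := Nat.one_le_two_pow
        zify [h1, (by omega : 1 ≤ 2 ^ n * 2)]
        ring
      rw [e]; exact h
    -- one halving step towards the level of `lh`, then the induction hypothesis at rank index `κ ⊕ κ`
    have step : ∀ (lh : Fin K) (b : ℕ), d lh ≤ 2 * b → ∀ i, b = d l₁ * i → i ≤ 2 ^ n →
        ((((∑ l, (X : ℝ[X]) ^ d l • (S l).map C) + (X : ℝ[X]) ^ (2 * b - d lh) • (U * W * Uᵀ).map C).det.roots.toFinset.filter
          (fun t => 0 < t)).card) ≤ B := by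
      intro lh b hb i hbi hi
      rw [posRoots_graft_eq_posRoots_border d lh b hb S U W hWW]
      have hTsymm : ∀ l, (fromBlocks (S l) (0 : Matrix ι κ ℝ) (0 : Matrix κ ι ℝ) (if l = lh then -W else 0)).IsSymm := by
        intro l
        simp only [Matrix.IsSymm, fromBlocks_transpose, transpose_zero, (hS _).eq]
        congr 1
        split_ifs
        · rw [transpose_neg, hWt]
        · rw [transpose_zero]
      have hsplit : (∑ l, (X : ℝ[X]) ^ (Fin.snoc d b : Fin (K + 1) → ℕ) l •
          ((Fin.snoc (α := fun _ => Matrix (ι ⊕ κ) (ι ⊕ κ) ℝ)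
              (fun l => fromBlocks (S l) 0 0 (if l = lh then -W else 0))
              (fromBlocks 0 U Uᵀ 0) l).map C)) =
          (∑ l, (X : ℝ[X]) ^ d l • (fromBlocks (S l) (0 : Matrix ι κ ℝ) (0 : Matrix κ ι ℝ) (if l = lh then -W else 0)).map C) +
            (X : ℝ[X]) ^ (d l₁ * i) •
            ((fromBlocks U (0 : Matrix ι κ ℝ) (0 : Matrix κ κ ℝ) (1 : Matrix κ κ ℝ)) *
              (fromBlocks (0 : Matrix κ κ ℝ) (1 : Matrix κ κ ℝ) (1 : Matrix κ κ ℝ) (0 : Matrix κ κ ℝ)) *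
              (fromBlocks U (0 : Matrix ι κ ℝ) (0 : Matrix κ κ ℝ) (1 : Matrix κ κ ℝ))ᵀ).map C := by
        rw [Fin.sum_univ_castSucc, ← fromBlocks_offDiag_eq_gram, ← hbi]
        simp only [Fin.snoc_castSucc, Fin.snoc_last]
      rw [hsplit]
      exact ih i hi h' _ hTsymm _ _ pairing_mul_pairing pairing_transpose
    obtain ⟨i, rfl | rfl⟩ := Nat.even_or_odd' j
    · have hi : i ≤ 2 ^ n := by rw [pow_succ] at hj; omega
      have := step l₀ (d l₁ * i) (by rw [hl₀]; exact Nat.zero_le _) i rfl hi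
      rw [hl₀, Nat.sub_zero] at this
      rw [show d l₁ * (2 * i) = 2 * (d l₁ * i) by ring]
      exact this
    · have hi : i + 1 ≤ 2 ^ n := by rw [pow_succ] at hj; omega
      have := step l₁ (d l₁ * (i + 1)) (by nlinarith) (i + 1) rfl hi
      rw [show 2 * (d l₁ * (i + 1)) - d l₁ = d l₁ * (2 * i + 1) by
        rw [show 2 * (d l₁ * (i + 1)) = d l₁ * (2 * i + 1) + d l₁ by ring, Nat.add_sub_cancel]] at this
      exact this

end Dyadic

/-! ## §3 The corner graft: S4b's object is a class event at size `m + 2^{⌊log₂ D⌋+1} − 1 ≤ m + 2D − 1` -/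

section Corner

variable {m K B : ℕ}

/-- a rank-one letter in factored form: `u uᵀ = U·1·Uᵀ` with `U` the column `u`. [folklore] -/
theorem vecMulVec_self_eq_gram (u : Fin m → ℝ) :
    Matrix.vecMulVec u u =
      Matrix.replicateCol (Fin 1) u * (1 : Matrix (Fin 1) (Fin 1) ℝ) * (Matrix.replicateCol (Fin 1) u)ᵀ := by
  rw [Matrix.mul_one, Matrix.transpose_replicateCol]
  exact Matrix.vecMulVec_eq (Fin 1) u u

/-- **RANK-ONE GRAFTS AT A DYADIC MULTIPLE OF A LEVEL.**  On a support through `0`: a rank-one far letter `u uᵀ` at level `j·d l₁`,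
`j ≤ 2ⁿ`, costs the `K`-letter class ONE extra row per halving: `Z₊ ≤ B` whenever `PosRootLawOn (m + (2ⁿ − 1)) K B d`. [this work] -/
theorem card_posRoots_rankOneGraft_dyadic_le (d : Fin K → ℕ) (l₀ : Fin K) (hl₀ : d l₀ = 0) (l₁ : Fin K) (n j : ℕ)
    (hj : j ≤ 2 ^ n) (h : PosRootLawOn (m + (2 ^ n - 1)) K B d)
    (S : Fin K → Matrix (Fin m) (Fin m) ℝ) (hS : ∀ l, (S l).IsSymm) (u : Fin m → ℝ) :
    ((((∑ l, (X : ℝ[X]) ^ d l • (S l).map C) + (X : ℝ[X]) ^ (d l₁ * j) • (Matrix.vecMulVec u u).map C).det.roots.toFinset.filter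
        (fun t => 0 < t)).card) ≤ B := by
  have h' : PosRootLawOn (Fintype.card (Fin m) + Fintype.card (Fin 1) * (2 ^ n - 1)) K B d := by
    rwa [Fintype.card_fin, Fintype.card_fin, one_mul]
  rw [vecMulVec_self_eq_gram]
  exact card_posRoots_graft_dyadic_le d l₀ hl₀ l₁ n j hj h' S hS _ _ (Matrix.mul_one 1) transpose_one

/-- **THE CORNER GRAFT IS A CLASS EVENT AT SIZE `m + 2^{⌊log₂D⌋+1} − 1`.**  On a support through the levels `0` and `1`, for EVERY level
`D`: `Z₊(det (G + X^D·eᵢeᵢᵀ)) ≤ ζ₊(m + 2^{⌊log₂ D⌋+1} − 1; d) ≤ ζ₊(m + 2D − 1; d)` — S4b's object `det G + X^D·det G_{ii}` is absorbed by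
the `K`-letter class at an ADDITIVE size cost linear in the level (the all-rank exchange of the prequel costs `2^{⌊log₂D⌋+1}·m`).
For the line's FAR levels `D > m·max d` the residual absorption at size `2m+1` (`…TowerGraftResidualDeterminant`) is sharper; this one
wins for `2^{⌊log₂D⌋+1} ≤ m + 1`. [this work] -/
theorem card_posRoots_cornerGraft_le_of_log (d : Fin K → ℕ) (l₀ l₁ : Fin K) (hl₀ : d l₀ = 0) (hl₁ : d l₁ = 1) (D : ℕ)
    (h : PosRootLawOn (m + (2 ^ (Nat.log 2 D + 1) - 1)) K B d)
    (S : Fin K → Matrix (Fin m) (Fin m) ℝ) (hS : ∀ l, (S l).IsSymm) (i : Fin m) :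
    ((((∑ l, (X : ℝ[X]) ^ d l • (S l).map C) + (X : ℝ[X]) ^ D •
        (Matrix.vecMulVec (Pi.single i (1 : ℝ)) (Pi.single i (1 : ℝ))).map C).det.roots.toFinset.filter
        (fun t => 0 < t)).card) ≤ B := by
  have := card_posRoots_rankOneGraft_dyadic_le d l₀ hl₀ l₁ (Nat.log 2 D + 1) D
    (Nat.lt_pow_succ_log_self one_lt_two D).le h S hS (Pi.single i (1 : ℝ))
  rwa [hl₁, one_mul] at this

end Corner

end Summit.ValiantsHypothesis.ValiantsHypothesis.Theorems.KPlusLogSqLaw.TowerGraft
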